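import Summits.BirchSwinnertonDyer.Rank1Residual.P2.CMKolyvaginHabitatTwentySevenA4
import Summits.BirchSwinnertonDyer.Rank1Residual.P2.CMKolyvaginHabitatMordell
import Summits.BirchSwinnertonDyer.Rank1Residual.P2.CornerFTwoModelAtlas
import Summits.BirchSwinnertonDyer.Rank1Residual.X12.RamifiedLocalTypes
import Literature.NumberTheory.EllipticCurves.NeronComponentIndexTypeIIIProofs
import Literature.NumberTheory.EllipticCurves.NeronComponentIndexTypeIIIstarProofs
import HarnessLib

/-!
# Route `CMKolyvaginAtInertTwo` (leaf `WAllCornerFTwo`): the arithmetic habitat `H₂` on the WHOLE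
# CM-inert-at-2 atlas — the five odd Heegner classes are OFF (`c_q = 2`), and the capstone

Cell `bsd-print-cf2`, seat ty2 (discharge interface), line `route-BirchSwinnertonDyer-CMKolyvaginAtInertTwo`
(items stmt-BirchSwinnertonDyer-24276/24277, residual 22838). HONEST FRAMING: THEOREMS ONLY — no
definition, no named fact, no route file imported, nothing about BSD asserted or booked; the leaf is OPEN.

The route's habitat `H₂` asks of a CM curve `E/ℚ`: `2` inert in `F = Frac End E`, `ρ̄_{E,2}` onto
`GL₂(𝔽₂)`, `Odd ∏ c_ℓ`, (and an optimal parametrisation with odd Manin constant, `r_an = 1`). By the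
tree's `CornerFTwo.inertAtlas` a CM curve with `2` inert is ℚ-isomorphic to a member of one of
eight explicit families (a)–(h). Rows (a) (`y² = x³ + k`) and (c) (twists of `27a4`) were decided in
`CMKolyvaginHabitatMordell` / `CMKolyvaginHabitatTwentySevenA4`; row (b) (`j = 54000`) fails the image
binder (rational `2`-torsion). This file closes the atlas:

* §1 `kodairaSymbolAt_of_j_oddHeegner` — **every curve over `ℚ` with
  `j ∈ {−2¹⁵, −2¹⁵3³, −2¹⁸3³5³, −2¹⁵3³5³11³, −2¹⁸3³5³23³29³}`** (the classes of
  `121b1, 361a1, 1849a1, 4489a1, 26569a1` = Gross's `A(q)`, `q = 11, 19, 43, 67, 163`, and all their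
  twists — rows (d)–(h)) **has Kodaira type `III` or `III*` at the place over `q`** (the tree's X12
  engine `X12.kodairaSymbolAt_of_j_eq_short`: `W ≅ E₀^{(n)}` for the short model `E₀` of `A(q)` with
  `q ∥ A`, `q² ∣ B`, `q³ ∥ Δ`; Tate's algorithm Steps 1–4 / 1–9);
* §2 `localTamagawaNumber_eq_two_of_j_oddHeegner`, **`not_odd_tamagawaProduct_of_j_oddHeegner`** —
  hence `c_q = 2` (Tate's algorithm Steps 4 and 9: `c(III) = c(III*) = 2`, the tree's discharged
  local-index theorems) and the Tamagawa product is EVEN: rows (d)–(h) are OFF `H₂`, every member,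
  every model (residual item 22838's "five odd inert CM fields (c_q = 2 at the CM prime)");
* §3 `not_hasSurjectiveModNGaloisRep_two_of_j_eq_54000` — row (b) is OFF `H₂` (image binder);
* §4 **`surjective_and_odd_tamagawaProduct_iff_of_cmInert_two` — THE CAPSTONE: for `E/ℚ` with CM and
  `2` inert, `(ρ̄_{E,2} onto ∧ Odd ∏ c_ℓ) ⟺ E ≅ (y² = x³ + k)` with `k ∈ ℤ ∖ ℤ³` satisfying the
  three-clause Tamagawa criterion of `Mordell.odd_tamagawaProduct_of_model_iff`, OR `E ≅ 27a4^{(d)}`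
  with `d` square-free and silent** (no root of `4x³ − 120x + 253` modulo any prime `p ≥ 5` dividing
  `d`). So the arithmetic part of `H₂` is an explicit decidable predicate on the atlas parameters.

Numerical cross-check (EVIDENCE, not used): kit j295793 (PARI `elllocalred`/`ellglobalred` on all
square-free twists `|d| ≤ 2000` of the five `A(q)`: `c_q = 2` and even Tamagawa product in every case).

References: Silverman *ATAEC* IV.9.4 (Steps 1–9, Table 4.1) [SilvermanATAEC1994]; Silverman *AEC* X.5
Prop. 5.4 [SilvermanAEC2009]; Cremona's tables (121b1, 361a1, 1849a1, 4489a1, 26569a1) [Cremona1997];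
B. Gross, *Arithmetic on elliptic curves with complex multiplication*, LNM 776 (1980) §§22–24 (the curves
`A(q)`); Dokchitser–Dokchitser, Math. Z. (2012) Thm. (1) [DokchitserDokchitserMathZ2012].
-/

set_option autoImplicit false

noncomputable section

open scoped Classical NumberField

open WeierstrassCurve NumberField IsDedekindDomain IsDedekindDomain.HeightOneSpectrum Rat.HeightOneSpectrum
  Literature.NumberTheory.EllipticCurves Literature.NumberTheory.EllipticCurves.Rank1Residual
  Literature.NumberTheory.EllipticCurves.Rank1Residual.X11RankOneCertificates
  Summit.BirchSwinnertonDyer.Rank1Residual Summit.BirchSwinnertonDyer.Rank1Residual.X11b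
  Summit.BirchSwinnertonDyer.Rank1Residual.P2

namespace Summit.BirchSwinnertonDyer.Rank1Residual.P2.InertAtlas

variable (W : WeierstrassCurve ℚ) [W.IsElliptic]

/-! ## §1 Kodaira type `III`/`III*` at the CM prime of the five odd Heegner classes, from `j` alone -/

/-- **`j = −2¹⁵` (class of `121b1 = A(11)`): type `III` or `III*` at the place over `11`** — short model
`y² = x³ − 9504x + 365904` (`11 ∥ A`, `11² ∣ B`, `Δ = −2¹²3¹²11³`), *AEC* X.5.4 and Tate's algorithm.
[cite: SilvermanATAEC1994, IV.9.4 Steps 1–9 (PDF pp. 344–346) and Table 4.1] [cite: SilvermanAEC2009, X.5 Prop. 5.4]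
[cite: Cremona1997, Table 1 (curve 121b1)] -/
theorem kodairaSymbolAt_of_j_cm11 (hj : W.j = -32768) (v : HeightOneSpectrum (𝓞 ℚ))
    (hv : natGenerator v = 11) : W.kodairaSymbolAt v = .III ∨ W.kodairaSymbolAt v = .IIIstar := by
  haveI := isElliptic_of_discOf_ne_zero 0 0 0 (-9504) 365904 (by decide)
  have hjE : (⟨((0 : ℤ) : ℚ), ((0 : ℤ) : ℚ), ((0 : ℤ) : ℚ), ((-9504 : ℤ) : ℚ), ((365904 : ℤ) : ℚ)⟩ :
      WeierstrassCurve ℚ).j = -32768 := by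
    rw [j, Units.inv_mul_eq_iff_eq_mul, coe_Δ']
    norm_num [WeierstrassCurve.c₄, WeierstrassCurve.Δ, WeierstrassCurve.b₂, WeierstrassCurve.b₄,
      WeierstrassCurve.b₆, WeierstrassCurve.b₈]
  refine X12.kodairaSymbolAt_of_j_eq_short W v (-9504) 365904 (-2897297289216)
    (by norm_num [WeierstrassCurve.Δ, WeierstrassCurve.b₂, WeierstrassCurve.b₄, WeierstrassCurve.b₆,
      WeierstrassCurve.b₈])
    ?_ ?_ ?_ ?_ ?_ (by push_cast at hjE ⊢; exact hj.trans hjE.symm) (by rw [hj]; norm_num)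
    (by rw [hj]; norm_num)
  all_goals rw [hv]; norm_num

/-- **`j = −2¹⁵3³` (class of `361a1 = A(19)`): type `III` or `III*` at the place over `19`** — short
model `y² = x³ − 49248x + 4210704` (`Δ = −2¹²3¹²19³`). [cite: SilvermanATAEC1994, IV.9.4 and Table 4.1]
[cite: SilvermanAEC2009, X.5 Prop. 5.4] [cite: Cremona1997, Table 1 (curve 361a1)] -/
theorem kodairaSymbolAt_of_j_cm19 (hj : W.j = -884736) (v : HeightOneSpectrum (𝓞 ℚ))
    (hv : natGenerator v = 19) : W.kodairaSymbolAt v = .III ∨ W.kodairaSymbolAt v = .IIIstar := by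
  haveI := isElliptic_of_discOf_ne_zero 0 0 0 (-49248) 4210704 (by decide)
  have hjE : (⟨((0 : ℤ) : ℚ), ((0 : ℤ) : ℚ), ((0 : ℤ) : ℚ), ((-49248 : ℤ) : ℚ), ((4210704 : ℤ) : ℚ)⟩ :
      WeierstrassCurve ℚ).j = -884736 := by
    rw [j, Units.inv_mul_eq_iff_eq_mul, coe_Δ']
    norm_num [WeierstrassCurve.c₄, WeierstrassCurve.Δ, WeierstrassCurve.b₂, WeierstrassCurve.b₄,
      WeierstrassCurve.b₆, WeierstrassCurve.b₈]
  refine X12.kodairaSymbolAt_of_j_eq_short W v (-49248) 4210704 (-14930550042624)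
    (by norm_num [WeierstrassCurve.Δ, WeierstrassCurve.b₂, WeierstrassCurve.b₄, WeierstrassCurve.b₆,
      WeierstrassCurve.b₈])
    ?_ ?_ ?_ ?_ ?_ (by push_cast at hjE ⊢; exact hj.trans hjE.symm) (by rw [hj]; norm_num)
    (by rw [hj]; norm_num)
  all_goals rw [hv]; norm_num

/-- **`j = −2¹⁸3³5³` (class of `1849a1 = A(43)`): type `III` or `III*` at the place over `43`** — short
model `y² = x³ − 1114560x + 452901456` (`Δ = −2¹²3¹²43³`). [cite: SilvermanATAEC1994, IV.9.4 and Table 4.1]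
[cite: SilvermanAEC2009, X.5 Prop. 5.4] [cite: Cremona1997, Table 1 (curve 1849a1)] -/
theorem kodairaSymbolAt_of_j_cm43 (hj : W.j = -884736000) (v : HeightOneSpectrum (𝓞 ℚ))
    (hv : natGenerator v = 43) : W.kodairaSymbolAt v = .III ∨ W.kodairaSymbolAt v = .IIIstar := by
  haveI := isElliptic_of_discOf_ne_zero 0 0 0 (-1114560) 452901456 (by decide)
  have hjE : (⟨((0 : ℤ) : ℚ), ((0 : ℤ) : ℚ), ((0 : ℤ) : ℚ), ((-1114560 : ℤ) : ℚ),
      ((452901456 : ℤ) : ℚ)⟩ : WeierstrassCurve ℚ).j = -884736000 := by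
    rw [j, Units.inv_mul_eq_iff_eq_mul, coe_Δ']
    norm_num [WeierstrassCurve.c₄, WeierstrassCurve.Δ, WeierstrassCurve.b₂, WeierstrassCurve.b₄,
      WeierstrassCurve.b₆, WeierstrassCurve.b₈]
  refine X12.kodairaSymbolAt_of_j_eq_short W v (-1114560) 452901456 (-173069433188352)
    (by norm_num [WeierstrassCurve.Δ, WeierstrassCurve.b₂, WeierstrassCurve.b₄, WeierstrassCurve.b₆,
      WeierstrassCurve.b₈])
    ?_ ?_ ?_ ?_ ?_ (by push_cast at hjE ⊢; exact hj.trans hjE.symm) (by rw [hj]; norm_num)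
    (by rw [hj]; norm_num)
  all_goals rw [hv]; norm_num

/-- **`j = −2¹⁵3³5³11³` (class of `4489a1 = A(67)`): type `III` or `III*` at the place over `67`** —
short model `y² = x³ − 9551520x + 11362054032` (`Δ = −2¹²3¹²67³`). [cite: SilvermanATAEC1994, IV.9.4 and Table 4.1]
[cite: SilvermanAEC2009, X.5 Prop. 5.4] [cite: Cremona1997, Table 1 (curve 4489a1)] -/
theorem kodairaSymbolAt_of_j_cm67 (hj : W.j = -147197952000) (v : HeightOneSpectrum (𝓞 ℚ))
    (hv : natGenerator v = 67) : W.kodairaSymbolAt v = .III ∨ W.kodairaSymbolAt v = .IIIstar := by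
  haveI := isElliptic_of_discOf_ne_zero 0 0 0 (-9551520) 11362054032 (by decide)
  have hjE : (⟨((0 : ℤ) : ℚ), ((0 : ℤ) : ℚ), ((0 : ℤ) : ℚ), ((-9551520 : ℤ) : ℚ),
      ((11362054032 : ℤ) : ℚ)⟩ : WeierstrassCurve ℚ).j = -147197952000 := by
    rw [j, Units.inv_mul_eq_iff_eq_mul, coe_Δ']
    norm_num [WeierstrassCurve.c₄, WeierstrassCurve.Δ, WeierstrassCurve.b₂, WeierstrassCurve.b₄,
      WeierstrassCurve.b₆, WeierstrassCurve.b₈]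
  refine X12.kodairaSymbolAt_of_j_eq_short W v (-9551520) 11362054032 (-654695585722368)
    (by norm_num [WeierstrassCurve.Δ, WeierstrassCurve.b₂, WeierstrassCurve.b₄, WeierstrassCurve.b₆,
      WeierstrassCurve.b₈])
    ?_ ?_ ?_ ?_ ?_ (by push_cast at hjE ⊢; exact hj.trans hjE.symm) (by rw [hj]; norm_num)
    (by rw [hj]; norm_num)
  all_goals rw [hv]; norm_num

/-- **`j = −2¹⁸3³5³23³29³` (class of `26569a1 = A(163)`): type `III` or `III*` at the place over
`163`** — short model `y² = x³ − 2818048320x + 57579881513616` (`Δ = −2¹²3¹²163³`).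
[cite: SilvermanATAEC1994, IV.9.4 and Table 4.1] [cite: SilvermanAEC2009, X.5 Prop. 5.4]
[cite: Cremona1997, Table 1 (curve 26569a1)] -/
theorem kodairaSymbolAt_of_j_cm163 (hj : W.j = -262537412640768000) (v : HeightOneSpectrum (𝓞 ℚ))
    (hv : natGenerator v = 163) : W.kodairaSymbolAt v = .III ∨ W.kodairaSymbolAt v = .IIIstar := by
  haveI := isElliptic_of_discOf_ne_zero 0 0 0 (-2818048320) 57579881513616 (by decide)
  have hjE : (⟨((0 : ℤ) : ℚ), ((0 : ℤ) : ℚ), ((0 : ℤ) : ℚ), ((-2818048320 : ℤ) : ℚ),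
      ((57579881513616 : ℤ) : ℚ)⟩ : WeierstrassCurve ℚ).j = -262537412640768000 := by
    rw [j, Units.inv_mul_eq_iff_eq_mul, coe_Δ']
    norm_num [WeierstrassCurve.c₄, WeierstrassCurve.Δ, WeierstrassCurve.b₂, WeierstrassCurve.b₄,
      WeierstrassCurve.b₆, WeierstrassCurve.b₈]
  refine X12.kodairaSymbolAt_of_j_eq_short W v (-2818048320) 57579881513616 (-9427093571284992)
    (by norm_num [WeierstrassCurve.Δ, WeierstrassCurve.b₂, WeierstrassCurve.b₄, WeierstrassCurve.b₆,
      WeierstrassCurve.b₈])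
    ?_ ?_ ?_ ?_ ?_ (by push_cast at hjE ⊢; exact hj.trans hjE.symm) (by rw [hj]; norm_num)
    (by rw [hj]; norm_num)
  all_goals rw [hv]; norm_num

/-- **The five odd Heegner classes together:** for `j(E)` one of the five values there is a prime
`q ∈ {11, 19, 43, 67, 163}` at whose place `E` has Kodaira type `III` or `III*`.
[cite: SilvermanATAEC1994, IV.9.4 and Table 4.1] [cite: SilvermanAEC2009, X.5 Prop. 5.4] -/
theorem kodairaSymbolAt_of_j_oddHeegner
    (hj : W.j = -32768 ∨ W.j = -884736 ∨ W.j = -884736000 ∨ W.j = -147197952000 ∨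
      W.j = -262537412640768000) :
    ∃ v : HeightOneSpectrum (𝓞 ℚ), W.kodairaSymbolAt v = .III ∨ W.kodairaSymbolAt v = .IIIstar := by
  rcases hj with hj | hj | hj | hj | hj
  · obtain ⟨v, hv⟩ := P2.Mordell.exists_place_natGenerator_eq (by norm_num : (11 : ℕ).Prime)
    exact ⟨v, kodairaSymbolAt_of_j_cm11 W hj v hv⟩
  · obtain ⟨v, hv⟩ := P2.Mordell.exists_place_natGenerator_eq (by norm_num : (19 : ℕ).Prime)
    exact ⟨v, kodairaSymbolAt_of_j_cm19 W hj v hv⟩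
  · obtain ⟨v, hv⟩ := P2.Mordell.exists_place_natGenerator_eq (by norm_num : (43 : ℕ).Prime)
    exact ⟨v, kodairaSymbolAt_of_j_cm43 W hj v hv⟩
  · obtain ⟨v, hv⟩ := P2.Mordell.exists_place_natGenerator_eq (by norm_num : (67 : ℕ).Prime)
    exact ⟨v, kodairaSymbolAt_of_j_cm67 W hj v hv⟩
  · obtain ⟨v, hv⟩ := P2.Mordell.exists_place_natGenerator_eq (by norm_num : (163 : ℕ).Prime)
    exact ⟨v, kodairaSymbolAt_of_j_cm163 W hj v hv⟩

/-! ## §2 `c_q = 2`: the Tamagawa product is even on rows (d)–(h) -/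

/-- **`c_v = 2` at a place of type `III` or `III*`** (Tate's algorithm Steps 4 and 9; the tree's
discharged local-index theorems). [cite: SilvermanATAEC1994, IV.9.4 Steps 4 and 9 (PDF pp. 344–346) and Table 4.1] -/
theorem localTamagawaNumber_eq_two_of_III_or_IIIstar (v : HeightOneSpectrum (𝓞 ℚ))
    (h : W.kodairaSymbolAt v = .III ∨ W.kodairaSymbolAt v = .IIIstar) :
    (W.baseChange (v.adicCompletion ℚ)).localTamagawaNumber (v.adicCompletionIntegers ℚ) = 2 := by
  haveI := perfectField_residueField_adicCompletionIntegers (K := ℚ) v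
  rcases h with h | h
  · exact localTamagawaNumber_eq_two_of_kodairaSymbolAt_eq_III_holds v W h
  · exact localTamagawaNumber_eq_two_of_kodairaSymbolAt_eq_IIIstar_holds v W h

/-- **A place of type `III` or `III*` makes the Tamagawa product even.** [cite: SilvermanATAEC1994, IV.9.4 and Table 4.1] -/
theorem not_odd_tamagawaProduct_of_III_or_IIIstar (v : HeightOneSpectrum (𝓞 ℚ))
    (h : W.kodairaSymbolAt v = .III ∨ W.kodairaSymbolAt v = .IIIstar) : ¬ Odd W.tamagawaProduct := by
  intro hodd
  have h2 := (P2.CubeSum.odd_tamagawaProduct_iff W).mp hodd v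
  rw [localTamagawaNumber_eq_two_of_III_or_IIIstar W v h] at h2
  exact absurd h2 (by decide)

/-- **`c_q = 2` on the five odd Heegner classes:** every curve with one of the five `j`-invariants has
a place with local Tamagawa number `2`. [cite: SilvermanATAEC1994, IV.9.4 and Table 4.1]
[cite: Cremona1997, Table 1 (curves 121b1, 361a1, 1849a1, 4489a1, 26569a1)] -/
theorem localTamagawaNumber_eq_two_of_j_oddHeegner
    (hj : W.j = -32768 ∨ W.j = -884736 ∨ W.j = -884736000 ∨ W.j = -147197952000 ∨
      W.j = -262537412640768000) :
    ∃ v : HeightOneSpectrum (𝓞 ℚ),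
      (W.baseChange (v.adicCompletion ℚ)).localTamagawaNumber (v.adicCompletionIntegers ℚ) = 2 := by
  obtain ⟨v, hv⟩ := kodairaSymbolAt_of_j_oddHeegner W hj
  exact ⟨v, localTamagawaNumber_eq_two_of_III_or_IIIstar W v hv⟩

/-- **ROWS (d)–(h) ARE OFF THE HABITAT: the Tamagawa product of every curve over `ℚ` with
`j ∈ {−2¹⁵, −2¹⁵3³, −2¹⁸3³5³, −2¹⁵3³5³11³, −2¹⁸3³5³23³29³}` is EVEN** (all twists of
`121b1, 361a1, 1849a1, 4489a1, 26569a1`, every model). [cite: SilvermanATAEC1994, IV.9.4 and Table 4.1]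
[cite: SilvermanAEC2009, X.5 Prop. 5.4] [cite: Cremona1997, Table 1] -/
theorem not_odd_tamagawaProduct_of_j_oddHeegner
    (hj : W.j = -32768 ∨ W.j = -884736 ∨ W.j = -884736000 ∨ W.j = -147197952000 ∨
      W.j = -262537412640768000) : ¬ Odd W.tamagawaProduct := by
  obtain ⟨v, hv⟩ := kodairaSymbolAt_of_j_oddHeegner W hj
  exact not_odd_tamagawaProduct_of_III_or_IIIstar W v hv

/-- Model form of the previous theorem for the atlas rows (d)–(h): a twist of one of the five bases,
read through any ℚ-isomorphism. [cite: SilvermanAEC2009, X.5 Prop. 5.4] [cite: SilvermanATAEC1994, IV.9.4] -/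
theorem not_odd_tamagawaProduct_of_smul_twist_oddHeegner {E : WeierstrassCurve ℚ} [E.IsElliptic]
    (hE : E = cm11 ∨ E = cm19 ∨ E = cm43 ∨ E = cm67 ∨ E = cm163) {d : ℚ} (hd : d ≠ 0)
    {C : VariableChange ℚ} (hC : C • E.quadraticTwist d = W) : ¬ Odd W.tamagawaProduct := by
  refine not_odd_tamagawaProduct_of_j_oddHeegner W ?_
  rw [CornerFTwo.Atlas.j_eq_of_smul_twist (W := W) hd hC]
  rcases hE with rfl | rfl | rfl | rfl | rfl
  · exact Or.inl j_cm11
  · exact Or.inr (Or.inl j_cm19)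
  · exact Or.inr (Or.inr (Or.inl j_cm43))
  · exact Or.inr (Or.inr (Or.inr (Or.inl j_cm67)))
  · exact Or.inr (Or.inr (Or.inr (Or.inr j_cm163)))

/-! ## §3 Row (b): `j = 54000` is off the habitat by the image binder -/

/-- **`j = 54000` ⟹ `ρ̄_{E,2}` is NOT onto `GL₂(𝔽₂)`** (CM by `ℤ[√−3]`, a rational `2`-torsion point;
Dokchitser–Dokchitser's table, tree theorem
`hasSurjectiveModNGaloisRep_two_iff_of_cmInert_two_of_j_ne_zero`). [cite: DokchitserDokchitserMathZ2012, Theorem (1)] -/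
theorem not_hasSurjectiveModNGaloisRep_two_of_j_eq_54000 (hj : W.j = 54000) :
    ¬ W.HasSurjectiveModNGaloisRep 2 := by
  obtain ⟨hCM, hin⟩ := CornerFTwo.hasCM_and_cmInert_two_of_j (W := W) (Or.inl hj)
  rw [P2.hasSurjectiveModNGaloisRep_two_iff_of_cmInert_two_of_j_ne_zero W hCM hin (by rw [hj]; norm_num)]
  exact fun h => h hj

/-! ## §4 The capstone: the arithmetic habitat on the CM-inert-at-2 atlas, in closed form -/

/-- **THE ARITHMETIC HABITAT `H₂` ON THE CM-INERT-AT-2 LOCUS, DECIDED.** For an elliptic curve `E/ℚ`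
with CM and `2` inert in `Frac End E`:
`(ρ̄_{E,2} onto GL₂(𝔽₂) ∧ Odd ∏ c_ℓ(E)) ⟺`
EITHER `E ≅ (y² = x³ + k)` for some `k ∈ ℤ ∖ {0}` which is not a cube and satisfies the three-clause
criterion (`a_p = v_p(k)`, `u_p = k/p^{a_p}`: not [`a₂ ≡ 3 (6)` or (`a₂ ≡ 2 (6)` and `u₂ ≡ 3 (4)`)];
not [`3 ∣ a₃` and `u₃ ≡ ±1 (9)`]; no prime `p ≥ 5` with `a_p ≡ 3 (6)` and `u_p` a cube mod `p`),
OR `E ≅ 27a4^{(d)}` for a square-free `d` which is silent (no root of `4x³ − 120x + 253` modulo any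
prime `p ≥ 5` dividing `d`). Assembly of the atlas `CornerFTwo.inertAtlas` with rows (a)
`Mordell.arithmeticHabitat_of_model_iff`, (b) §3, (c) `TwentySevenA4.arithmeticHabitat_twist_iff`,
(d)–(h) §2. [cite: SilvermanATAEC1994, IV.9.4 and Table 4.1] [cite: Rizzo2003, Table II (p. 4)]
[cite: BoxerDiao2010, proof of Prop. 4.1 (pp. 1976–1977)] [cite: DokchitserDokchitserMathZ2012, Theorem (1)]
[cite: SilvermanAEC2009, X.5 Prop. 5.4 and Cor. 5.4.1] -/
theorem surjective_and_odd_tamagawaProduct_iff_of_cmInert_two (hCM : W.HasCM) (hin : CMInert W 2) :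
    (W.HasSurjectiveModNGaloisRep 2 ∧ Odd W.tamagawaProduct) ↔
      ((∃ k : ℤ, k ≠ 0 ∧ (∃ C : VariableChange ℚ, C • (⟨0, 0, 0, 0, (k : ℚ)⟩ : WeierstrassCurve ℚ) = W) ∧
          (¬ ∃ t : ℤ, t ^ 3 = k) ∧
          ¬ (k.natAbs.factorization 2 % 6 = 3 ∨
              (k.natAbs.factorization 2 % 6 = 2 ∧ k / (2 : ℤ) ^ k.natAbs.factorization 2 % 4 = 3)) ∧
          ¬ (k.natAbs.factorization 3 % 3 = 0 ∧
              (k / 3 ^ k.natAbs.factorization 3 % 9 = 1 ∨ k / 3 ^ k.natAbs.factorization 3 % 9 = 8)) ∧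
          ∀ p : ℕ, p.Prime → 5 ≤ p → k.natAbs.factorization p % 6 = 3 →
            ¬ ∃ s : ZMod p, s ^ 3 = ((k / (p : ℤ) ^ k.natAbs.factorization p : ℤ) : ZMod p)) ∨
        ∃ d : ℤ, d ≠ 0 ∧ Squarefree d ∧
          (∃ C : VariableChange ℚ,
            C • (⟨0, 0, 1, -30, 63⟩ : WeierstrassCurve ℚ).quadraticTwist (d : ℚ) = W) ∧
          ∀ p : ℕ, p.Prime → 5 ≤ p → (p : ℤ) ∣ d → ∀ x : ZMod p, 4 * x ^ 3 - 120 * x + 253 ≠ 0) := by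
  haveI := isElliptic_curve27a4
  constructor
  · rintro ⟨hs, ht⟩
    rcases CornerFTwo.inertAtlas (W := W) hCM hin with
      ⟨k, hk, C, hC⟩ | ⟨d, hd, hsq, C, hC⟩ | ⟨d, hd, hsq, C, hC⟩ | ⟨d, hd, hsq, C, hC⟩ |
      ⟨d, hd, hsq, C, hC⟩ | ⟨d, hd, hsq, C, hC⟩ | ⟨d, hd, hsq, C, hC⟩ | ⟨d, hd, hsq, C, hC⟩
    · -- row (a): `y² = x³ + k`
      obtain ⟨hsurj, h2, h3, h5⟩ :=
        (P2.Mordell.arithmeticHabitat_of_model_iff W hk hC).mp ⟨hCM, hin, hs, ht⟩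
      exact Or.inl ⟨k, hk, ⟨C, hC⟩,
        fun h => hsurj ((P2.Mordell.exists_rat_pow_three_eq_iff k).mpr h), h2, h3, h5⟩
    · -- row (b): `j = 54000`, no surjective image
      have hdq : (d : ℚ) ≠ 0 := by exact_mod_cast hd
      haveI := isElliptic_of_discOf_ne_zero 0 6 0 (-3) 0 (by decide)
      have hj : W.j = 54000 := by
        have h := CornerFTwo.Atlas.j_eq_of_smul_twist (W := W)
          (E := ⟨((0 : ℤ) : ℚ), ((6 : ℤ) : ℚ), ((0 : ℤ) : ℚ), ((-3 : ℤ) : ℚ), ((0 : ℤ) : ℚ)⟩) hdq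
          (C := C) (by push_cast; exact hC)
        rw [h]; push_cast; exact j_cm12
      exact absurd hs (not_hasSurjectiveModNGaloisRep_two_of_j_eq_54000 W hj)
    · -- row (c): `27a4^{(d)}`
      have hC' : C⁻¹ • W = (⟨0, 0, 1, -30, 63⟩ : WeierstrassCurve ℚ).quadraticTwist (d : ℚ) := by
        rw [← hC, inv_smul_smul]
      exact Or.inr ⟨d, hd, hsq, ⟨C, hC⟩,
        (P2.TwentySevenA4.arithmeticHabitat_twist_iff W hd hsq hC').mp ⟨hCM, hin, hs, ht⟩⟩
    · exact absurd ht (not_odd_tamagawaProduct_of_smul_twist_oddHeegner W (Or.inl rfl)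
        (by exact_mod_cast hd) hC)
    · exact absurd ht (not_odd_tamagawaProduct_of_smul_twist_oddHeegner W (Or.inr (Or.inl rfl))
        (by exact_mod_cast hd) hC)
    · exact absurd ht (not_odd_tamagawaProduct_of_smul_twist_oddHeegner W
        (Or.inr (Or.inr (Or.inl rfl))) (by exact_mod_cast hd) hC)
    · exact absurd ht (not_odd_tamagawaProduct_of_smul_twist_oddHeegner W
        (Or.inr (Or.inr (Or.inr (Or.inl rfl)))) (by exact_mod_cast hd) hC)
    · exact absurd ht (not_odd_tamagawaProduct_of_smul_twist_oddHeegner W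
        (Or.inr (Or.inr (Or.inr (Or.inr rfl)))) (by exact_mod_cast hd) hC)
  · rintro (⟨k, hk, ⟨C, hC⟩, hcube, h2, h3, h5⟩ | ⟨d, hd, hsq, ⟨C, hC⟩, hsil⟩)
    · obtain ⟨-, -, hs, ht⟩ := (P2.Mordell.arithmeticHabitat_of_model_iff W hk hC).mpr
        ⟨fun h => hcube ((P2.Mordell.exists_rat_pow_three_eq_iff k).mp h), h2, h3, h5⟩
      exact ⟨hs, ht⟩
    · have hC' : C⁻¹ • W = (⟨0, 0, 1, -30, 63⟩ : WeierstrassCurve ℚ).quadraticTwist (d : ℚ) := by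
        rw [← hC, inv_smul_smul]
      obtain ⟨-, -, hs, ht⟩ := (P2.TwentySevenA4.arithmeticHabitat_twist_iff W hd hsq hC').mpr hsil
      exact ⟨hs, ht⟩

/-- **Corollary (the residual side, item 22838): a CM curve with `2` inert which is NOT ℚ-isomorphic
to a Mordell curve `y² = x³ + k` nor to a twist of `27a4` has an even Tamagawa product or a
non-surjective `ρ̄₂`** — it is a model of row (b) or of rows (d)–(h). [cite: SilvermanAEC2009, X.5 Prop. 5.4]
[cite: SilvermanATAEC1994, IV.9.4 and Table 4.1] [cite: DokchitserDokchitserMathZ2012, Theorem (1)] -/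
theorem not_surjective_and_odd_of_not_mordell_of_not_twist27a4 (hCM : W.HasCM) (hin : CMInert W 2)
    (ha : ∀ k : ℤ, k ≠ 0 → ∀ C : VariableChange ℚ,
      C • (⟨0, 0, 0, 0, (k : ℚ)⟩ : WeierstrassCurve ℚ) ≠ W)
    (hc : ∀ d : ℤ, d ≠ 0 → Squarefree d → ∀ C : VariableChange ℚ,
      C • (⟨0, 0, 1, -30, 63⟩ : WeierstrassCurve ℚ).quadraticTwist (d : ℚ) ≠ W) :
    ¬ (W.HasSurjectiveModNGaloisRep 2 ∧ Odd W.tamagawaProduct) := fun h => by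
  rcases (surjective_and_odd_tamagawaProduct_iff_of_cmInert_two W hCM hin).mp h with
    ⟨k, hk, ⟨C, hC⟩, -⟩ | ⟨d, hd, hsq, ⟨C, hC⟩, -⟩
  · exact ha k hk C hC
  · exact hc d hd hsq C hC

end Summit.BirchSwinnertonDyer.Rank1Residual.P2.InertAtlas

end
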